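import Literature.InformationTheory.QuantumCodes.QuantumExpanderThresholdSharp
import Literature.InformationTheory.QuantumCodes.QuantumExpanderZSector
import HarnessLib

/-!
# FGL18 Theorem 1 with the printed threshold value `p_ls`: the `Z`-sector and both sectors of `Q_G` — PROOF

Index of sources: `[cite: FawziGrospellierLeverrier2018]` = Fawzi–Grospellier–Leverrier, STOC 2018 / arXiv:1711.08351v2:
Thm 1 (§1 p0004), its proof (end of §4, p0014 L1-16: "We let `p₀ = p_ls` …"), §2.3 (p0008 L1-6: "a decoding algorithm is
given by an `X`-decoding algorithm … and a `Z`-decoding algorithm"), Def 10 (`β₀`, symmetric in `δ_A`, `δ_B`).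

qec PARTITION v2 row 04 (`prover-qec-type-04`, gen 6), follow-on «04.SHARP-ZB» (lead g8 block 197 (1)). The tree's
`QuantumExpander.fgl18_theorem1_sharp` (`QuantumExpanderThresholdSharp.lean`) is the `X`-sector statement with every
constant explicit (threshold `p_ls(Δ_𝒢, α)`, `Δ_𝒢 = 2·max(Δ_A,Δ_B)·(Δ_A+Δ_B)`, `α = β̃/(1+β̃)`). Its bound is SYMMETRIC
under the exchange `A ↔ B` (`min`, `max`, `n_A² + n_B²`, `min(γ_A n_A, γ_B n_B)` and `β̃ = betaZero (min Δ) (max Δ) δ_A δ_B`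
are all symmetric — the tree's `betaZero_symm_delta`), so the `X`-sector theorem for `Gᵀ`, transported along the block swap of the
qubit labels exactly as in `QuantumExpanderZSector.lean`, gives:

* `fgl18_theorem1_sharp_zsector` — the same bound for every small-set-flip `Z`-decoder of `Q_G` (syndromes
  `expanderHZ H`, flips in the rows of `expanderHX H`) and every locally stochastic `Z`-noise of parameter `0 < p < p_ls`;
* `fgl18_theorem1_sharp_both_sectors` — for every nonnegative joint weight on pairs `(E_X, E_Z)` whose two marginals are
  locally stochastic of parameter `0 < p < p_ls`, the weight of the pairs on which `D_X` fails on `E_X` or `D_Z` fails on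
  `E_Z` is at most TWICE that bound (union bound).

The NUMBER `p_ls(Δ_𝒢, α)` is ours (degree bookkeeping, qec T-50; at `(38,39,1/38,1/39)` it is `8.888·10⁻¹⁷`,
`fgl18_theorem1_sharp_percolationValue_38_39`). All statements PROVED (kernel axioms); no definitions, no named facts.
-/

namespace Literature.InformationTheory.QuantumCodes

namespace QuantumExpander

open Finset Matrix

section SharpZ

variable {A B : Type} [Fintype A] [Fintype B] [DecidableEq A] [DecidableEq B]

open Classical in
/-- **FGL18 Theorem 1 with the printed threshold value, `Z`-sector of `Q_G` in its own coordinates.** For a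
`(Δ_A,Δ_B)`-biregular `(γ_A,δ_A,γ_B,δ_B)`-expanding `G` with `β̃ > 0`, every `κ ≤ β̃·max(Δ_A,Δ_B)`, every small-set-flip
decoder `D` of parameter `κ` for (syndromes `expanderHZ H`, flips in the rows of `expanderHX H`) and every locally
stochastic weight of parameter `0 < p < p_ls(Δ_𝒢, α)`: the same bound as `fgl18_theorem1_sharp` ("a `Z`-decoding algorithm
… exchanging the roles": the `X`-sector theorem for `Gᵀ`, transported along the block swap). STATUS: the printed theorem's
`Z`-half with OUR explicit constants. [cite: FawziGrospellierLeverrier2018, Thm 1 proof (arXiv v2 p0014 L1-16) with §2.3 (p0008 L1-6)] -/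
theorem fgl18_theorem1_sharp_zsector (H : Matrix B A (ZMod 2)) {dA dB : ℕ} {γA δA γB δB : ℝ}
    (hreg : IsBiregular H dA dB) (hexp : IsLeftRightExpanding H dA dB γA δA γB δB)
    (hdA : 0 < dA) (hdB : 0 < dB) (hγA : 0 < γA) (hδA : 0 < δA) (hγB : 0 < γB) (hδB : 0 < δB)
    (hβ : 0 < betaZero (min dA dB) (max dA dB) δA δB)
    {κ : ℝ} (hκ : κ ≤ betaZero (min dA dB) (max dA dB) δA δB * ((max dA dB : ℕ) : ℝ))
    {D : Decoder (B × A → ZMod 2) ((A × A) ⊕ (B × B) → ZMod 2)}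
    (hD : IsSSFDecoder κ (expanderHZ H) (expanderHX H) D)
    {p : ℝ} {μ : Finset ((A × A) ⊕ (B × B)) → ℝ} (hμ : IsLocallyStochastic μ p) (hp0 : 0 < p)
    (hp : p < percolationValue (2 * max dA dB * (dA + dB))
      (betaZero (min dA dB) (max dA dB) δA δB / (1 + betaZero (min dA dB) (max dA dB) δA δB))) :
    (∑ E ∈ univ.filter (fun E : Finset ((A × A) ⊕ (B × B)) =>
        ¬ D.Corrects (fun x => expanderHZ H *ᵥ x) (rowSpace (expanderHX H) : Set _) (flipVec E)), μ E)
      ≤ (1 / ((1 - Real.exp (Real.binEntropy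
                  (betaZero (min dA dB) (max dA dB) δA δB / (1 + betaZero (min dA dB) (max dA dB) δA δB)) /
                (betaZero (min dA dB) (max dA dB) δA δB / (1 + betaZero (min dA dB) (max dA dB) δA δB))) * p) *
              (1 - (p / percolationValue (2 * max dA dB * (dA + dB))
                (betaZero (min dA dB) (max dA dB) δA δB / (1 + betaZero (min dA dB) (max dA dB) δA δB))) ^
                  (betaZero (min dA dB) (max dA dB) δA δB / (1 + betaZero (min dA dB) (max dA dB) δA δB))))) *
        ((Fintype.card A : ℝ) ^ 2 + (Fintype.card B : ℝ) ^ 2) *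
        (p / percolationValue (2 * max dA dB * (dA + dB))
            (betaZero (min dA dB) (max dA dB) δA δB / (1 + betaZero (min dA dB) (max dA dB) δA δB))) ^
          ((betaZero (min dA dB) (max dA dB) δA δB / (1 + betaZero (min dA dB) (max dA dB) δA δB)) *
            ((⌊((min dA dB : ℕ) : ℝ) / ((max dA dB : ℕ) : ℝ) * betaZero (min dA dB) (max dA dB) δA δB
                / (1 + betaZero (min dA dB) (max dA dB) δA δB) * min (γA * Fintype.card A) (γB * Fintype.card B)⌋₊
                + 1 : ℕ) : ℝ)) := by
  set σ := Equiv.sumComm (A × A) (B × B) with hσ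
  rw [expanderHZ_eq_submatrix_swap H, expanderHX_eq_submatrix_swap H] at hD ⊢
  have hD' := isSSFDecoder_comp_equiv σ hD
  have hμ' := isLocallyStochastic_map_equiv σ hμ
  have hregT : IsBiregular Hᵀ dB dA := isBiregular_transpose H hreg
  have hexpT : IsLeftRightExpanding Hᵀ dB dA γB δB γA δA := by
    refine ⟨(isLeftExpanding_transpose_iff H dB γB δB).2 hexp.2, ?_⟩
    have h : IsLeftExpanding Hᵀᵀ dA γA δA := by rw [Matrix.transpose_transpose]; exact hexp.1
    exact (isLeftExpanding_transpose_iff Hᵀ dA γA δA).1 h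
  have hβT : 0 < betaZero (min dB dA) (max dB dA) δB δA := by
    rw [min_comm dB dA, max_comm dB dA, betaZero_symm_delta]; exact hβ
  have hκT : κ ≤ betaZero (min dB dA) (max dB dA) δB δA * ((max dB dA : ℕ) : ℝ) := by
    rw [min_comm dB dA, max_comm dB dA, betaZero_symm_delta]; exact hκ
  have hpT : p < percolationValue (2 * max dB dA * (dB + dA))
      (betaZero (min dB dA) (max dB dA) δB δA / (1 + betaZero (min dB dA) (max dB dA) δB δA)) := by
    rw [min_comm dB dA, max_comm dB dA, Nat.add_comm dB dA, betaZero_symm_delta]; exact hp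
  have h := fgl18_theorem1_sharp Hᵀ hregT hexpT hdB hdA hγB hδB hγA hδA hβT hκT hD' hμ' hp0 hpT
  rw [sum_filter_not_corrects_map_equiv σ D μ]
  rw [min_comm dB dA, max_comm dB dA, Nat.add_comm dB dA, betaZero_symm_delta,
    add_comm ((Fintype.card B : ℝ) ^ 2) ((Fintype.card A : ℝ) ^ 2),
    min_comm (γB * (Fintype.card B : ℝ)) (γA * (Fintype.card A : ℝ))] at h
  exact h

open Classical in
/-- **FGL18 Theorem 1 with the printed threshold value, both sectors of `Q_G` (union bound).** For a
`(Δ_A,Δ_B)`-biregular `(γ_A,δ_A,γ_B,δ_B)`-expanding `G` with `β̃ > 0`, every `κ ≤ β̃·max(Δ_A,Δ_B)`, every pair of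
small-set-flip decoders — `D_X` for (syndromes `expanderHX H`, generators `expanderHZ H`), `D_Z` for (syndromes
`expanderHZ H`, generators `expanderHX H`) — and every nonnegative joint weight `ν` on pairs `(E_X, E_Z)` whose two
marginals are locally stochastic of parameter `0 < p < p_ls(Δ_𝒢, α)`, the total `ν`-weight of the pairs on which `D_X`
fails on `E_X` or `D_Z` fails on `E_Z` is at most twice the bound of `fgl18_theorem1_sharp` ("a decoding algorithm is
given by an `X`-decoding algorithm … and a `Z`-decoding algorithm"). STATUS: printed theorem, both halves, OUR explicit
constants. [cite: FawziGrospellierLeverrier2018, Thm 1 (§1, arXiv v2 p0004) and its proof (p0014 L1-16) with §2.3 (p0008 L1-6)] -/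
theorem fgl18_theorem1_sharp_both_sectors (H : Matrix B A (ZMod 2)) {dA dB : ℕ} {γA δA γB δB : ℝ}
    (hreg : IsBiregular H dA dB) (hexp : IsLeftRightExpanding H dA dB γA δA γB δB)
    (hdA : 0 < dA) (hdB : 0 < dB) (hγA : 0 < γA) (hδA : 0 < δA) (hγB : 0 < γB) (hδB : 0 < δB)
    (hβ : 0 < betaZero (min dA dB) (max dA dB) δA δB)
    {κ : ℝ} (hκ : κ ≤ betaZero (min dA dB) (max dA dB) δA δB * ((max dA dB : ℕ) : ℝ))
    {DX : Decoder (A × B → ZMod 2) ((A × A) ⊕ (B × B) → ZMod 2)}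
    {DZ : Decoder (B × A → ZMod 2) ((A × A) ⊕ (B × B) → ZMod 2)}
    (hDX : IsSSFDecoder κ (expanderHX H) (expanderHZ H) DX) (hDZ : IsSSFDecoder κ (expanderHZ H) (expanderHX H) DZ)
    {p : ℝ} {ν : Finset ((A × A) ⊕ (B × B)) × Finset ((A × A) ⊕ (B × B)) → ℝ} (hp0 : 0 < p)
    (hp : p < percolationValue (2 * max dA dB * (dA + dB))
      (betaZero (min dA dB) (max dA dB) δA δB / (1 + betaZero (min dA dB) (max dA dB) δA δB)))
    (hν0 : ∀ P, 0 ≤ ν P)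
    (hν1 : ∀ T : Finset ((A × A) ⊕ (B × B)), ∑ P ∈ univ.filter (fun P => T ⊆ P.1), ν P ≤ p ^ T.card)
    (hν2 : ∀ T : Finset ((A × A) ⊕ (B × B)), ∑ P ∈ univ.filter (fun P => T ⊆ P.2), ν P ≤ p ^ T.card) :
    (∑ P ∈ univ.filter (fun P : Finset ((A × A) ⊕ (B × B)) × Finset ((A × A) ⊕ (B × B)) =>
        ¬ (DX.Corrects (fun x => expanderHX H *ᵥ x) (rowSpace (expanderHZ H) : Set _) (flipVec P.1) ∧
           DZ.Corrects (fun x => expanderHZ H *ᵥ x) (rowSpace (expanderHX H) : Set _) (flipVec P.2))), ν P)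
      ≤ 2 * ((1 / ((1 - Real.exp (Real.binEntropy
                  (betaZero (min dA dB) (max dA dB) δA δB / (1 + betaZero (min dA dB) (max dA dB) δA δB)) /
                (betaZero (min dA dB) (max dA dB) δA δB / (1 + betaZero (min dA dB) (max dA dB) δA δB))) * p) *
              (1 - (p / percolationValue (2 * max dA dB * (dA + dB))
                (betaZero (min dA dB) (max dA dB) δA δB / (1 + betaZero (min dA dB) (max dA dB) δA δB))) ^
                  (betaZero (min dA dB) (max dA dB) δA δB / (1 + betaZero (min dA dB) (max dA dB) δA δB))))) *
        ((Fintype.card A : ℝ) ^ 2 + (Fintype.card B : ℝ) ^ 2) *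
        (p / percolationValue (2 * max dA dB * (dA + dB))
            (betaZero (min dA dB) (max dA dB) δA δB / (1 + betaZero (min dA dB) (max dA dB) δA δB))) ^
          ((betaZero (min dA dB) (max dA dB) δA δB / (1 + betaZero (min dA dB) (max dA dB) δA δB)) *
            ((⌊((min dA dB : ℕ) : ℝ) / ((max dA dB : ℕ) : ℝ) * betaZero (min dA dB) (max dA dB) δA δB
                / (1 + betaZero (min dA dB) (max dA dB) δA δB) * min (γA * Fintype.card A) (γB * Fintype.card B)⌋₊
                + 1 : ℕ) : ℝ))) := by
  -- the two marginals
  set μX : Finset ((A × A) ⊕ (B × B)) → ℝ := fun E => ∑ P ∈ univ.filter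
    (fun P : Finset ((A × A) ⊕ (B × B)) × Finset ((A × A) ⊕ (B × B)) => P.1 = E), ν P with hμX
  set μZ : Finset ((A × A) ⊕ (B × B)) → ℝ := fun E => ∑ P ∈ univ.filter
    (fun P : Finset ((A × A) ⊕ (B × B)) × Finset ((A × A) ⊕ (B × B)) => P.2 = E), ν P with hμZ
  have hmargX : ∀ S : Finset (Finset ((A × A) ⊕ (B × B))),
      ∑ E ∈ S, μX E = ∑ P ∈ univ.filter
        (fun P : Finset ((A × A) ⊕ (B × B)) × Finset ((A × A) ⊕ (B × B)) => P.1 ∈ S), ν P := by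
    intro S
    rw [← Finset.sum_fiberwise_of_maps_to (s := univ.filter
      (fun P : Finset ((A × A) ⊕ (B × B)) × Finset ((A × A) ⊕ (B × B)) => P.1 ∈ S)) (t := S)
      (g := fun P => P.1) (fun P hP => (Finset.mem_filter.1 hP).2)]
    refine Finset.sum_congr rfl fun E hE => ?_
    rw [hμX, Finset.filter_filter]
    refine Finset.sum_congr ?_ fun _ _ => rfl
    ext P
    simp only [Finset.mem_filter, Finset.mem_univ, true_and]
    exact ⟨fun h => ⟨by rw [h]; exact hE, h⟩, fun h => h.2⟩
  have hmargZ : ∀ S : Finset (Finset ((A × A) ⊕ (B × B))),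
      ∑ E ∈ S, μZ E = ∑ P ∈ univ.filter
        (fun P : Finset ((A × A) ⊕ (B × B)) × Finset ((A × A) ⊕ (B × B)) => P.2 ∈ S), ν P := by
    intro S
    rw [← Finset.sum_fiberwise_of_maps_to (s := univ.filter
      (fun P : Finset ((A × A) ⊕ (B × B)) × Finset ((A × A) ⊕ (B × B)) => P.2 ∈ S)) (t := S)
      (g := fun P => P.2) (fun P hP => (Finset.mem_filter.1 hP).2)]
    refine Finset.sum_congr rfl fun E hE => ?_
    rw [hμZ, Finset.filter_filter]
    refine Finset.sum_congr ?_ fun _ _ => rfl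
    ext P
    simp only [Finset.mem_filter, Finset.mem_univ, true_and]
    exact ⟨fun h => ⟨by rw [h]; exact hE, h⟩, fun h => h.2⟩
  have hμXls : IsLocallyStochastic μX p := by
    refine ⟨fun E => Finset.sum_nonneg fun P _ => hν0 P, fun T => ?_⟩
    rw [hmargX]
    have : univ.filter (fun P : Finset ((A × A) ⊕ (B × B)) × Finset ((A × A) ⊕ (B × B)) =>
        P.1 ∈ univ.filter (fun E => T ⊆ E)) = univ.filter (fun P => T ⊆ P.1) := by
      ext P; simp
    rw [this]; exact hν1 T
  have hμZls : IsLocallyStochastic μZ p := by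
    refine ⟨fun E => Finset.sum_nonneg fun P _ => hν0 P, fun T => ?_⟩
    rw [hmargZ]
    have : univ.filter (fun P : Finset ((A × A) ⊕ (B × B)) × Finset ((A × A) ⊕ (B × B)) =>
        P.2 ∈ univ.filter (fun E => T ⊆ E)) = univ.filter (fun P => T ⊆ P.2) := by
      ext P; simp
    rw [this]; exact hν2 T
  -- failure events and the two sector bounds
  set FX : Finset (Finset ((A × A) ⊕ (B × B))) := univ.filter (fun E : Finset ((A × A) ⊕ (B × B)) =>
    ¬ DX.Corrects (fun x => expanderHX H *ᵥ x) (rowSpace (expanderHZ H) : Set _) (flipVec E)) with hFX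
  set FZ : Finset (Finset ((A × A) ⊕ (B × B))) := univ.filter (fun E : Finset ((A × A) ⊕ (B × B)) =>
    ¬ DZ.Corrects (fun x => expanderHZ H *ᵥ x) (rowSpace (expanderHX H) : Set _) (flipVec E)) with hFZ
  have hboundX := fgl18_theorem1_sharp H hreg hexp hdA hdB hγA hδA hγB hδB hβ hκ hDX hμXls hp0 hp
  have hboundZ := fgl18_theorem1_sharp_zsector H hreg hexp hdA hdB hγA hδA hγB hδB hβ hκ hDZ hμZls hp0 hp
  rw [← hFX] at hboundX
  rw [← hFZ] at hboundZ
  -- union bound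
  have hunion : ∑ P ∈ univ.filter (fun P : Finset ((A × A) ⊕ (B × B)) × Finset ((A × A) ⊕ (B × B)) =>
        ¬ (DX.Corrects (fun x => expanderHX H *ᵥ x) (rowSpace (expanderHZ H) : Set _) (flipVec P.1) ∧
           DZ.Corrects (fun x => expanderHZ H *ᵥ x) (rowSpace (expanderHX H) : Set _) (flipVec P.2))), ν P
      ≤ ∑ E ∈ FX, μX E + ∑ E ∈ FZ, μZ E := by
    rw [hmargX, hmargZ, ← Finset.sum_union_inter]
    have hsub : univ.filter (fun P : Finset ((A × A) ⊕ (B × B)) × Finset ((A × A) ⊕ (B × B)) =>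
        ¬ (DX.Corrects (fun x => expanderHX H *ᵥ x) (rowSpace (expanderHZ H) : Set _) (flipVec P.1) ∧
           DZ.Corrects (fun x => expanderHZ H *ᵥ x) (rowSpace (expanderHX H) : Set _) (flipVec P.2)))
        ⊆ univ.filter (fun P : Finset ((A × A) ⊕ (B × B)) × Finset ((A × A) ⊕ (B × B)) => P.1 ∈ FX)
          ∪ univ.filter (fun P => P.2 ∈ FZ) := by
      intro P hP
      simp only [hFX, hFZ, Finset.mem_filter, Finset.mem_union, Finset.mem_univ, true_and] at hP ⊢
      tauto
    have h1 := Finset.sum_le_sum_of_subset_of_nonneg hsub (fun P _ _ => hν0 P)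
    have h2 : 0 ≤ ∑ P ∈ univ.filter (fun P : Finset ((A × A) ⊕ (B × B)) × Finset ((A × A) ⊕ (B × B)) =>
        P.1 ∈ FX) ∩ univ.filter (fun P => P.2 ∈ FZ), ν P :=
      Finset.sum_nonneg fun P _ => hν0 P
    linarith
  linarith [hunion, hboundX, hboundZ]

end SharpZ


/-! ### Appended (qec-type-04 g6, same session): i.i.d. depolarizing noise -/

section SharpDepol

variable {A B : Type} [Fintype A] [Fintype B] [DecidableEq A] [DecidableEq B]

/-- In `𝔽₂` a non-zero element is `1`. [folklore] -/
private theorem zmod2_eq_one_of_ne_zero_sd {z : ZMod 2} (h : z ≠ 0) : z = 1 := by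
  revert z; decide

/-- `𝟙_{supp x} = x`. [folklore] -/
private theorem flipVec_supp_sd {Q : Type*} [Fintype Q] [DecidableEq Q] (x : Q → ZMod 2) :
    flipVec (supp x) = x := by
  funext q
  simp only [flipVec, supp, Finset.mem_filter, Finset.mem_univ, true_and]
  by_cases h : x q = 0
  · simp [h]
  · rw [if_pos h, zmod2_eq_one_of_ne_zero_sd h]

/-- `supp 𝟙_E = E`. [folklore] -/
private theorem supp_flipVec_sd {Q : Type*} [Fintype Q] [DecidableEq Q] (E : Finset Q) :
    supp (flipVec E) = E := by
  ext q
  simp [supp, flipVec]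

/-- Re-indexing a sum over binary vectors by their supports. [folklore] -/
private theorem sum_filter_supp_eq_sd {Q : Type*} [Fintype Q] [DecidableEq Q] (P : (Q → ZMod 2) → Prop)
    [DecidablePred P] [DecidablePred fun E : Finset Q => P (flipVec E)] (w : Finset Q → ℝ) :
    ∑ x ∈ univ.filter P, w (supp x) = ∑ E ∈ univ.filter (fun E : Finset Q => P (flipVec E)), w E := by
  refine Finset.sum_nbij' supp flipVec ?_ ?_ ?_ ?_ ?_
  · intro x hx
    rw [Finset.mem_filter] at hx ⊢
    exact ⟨Finset.mem_univ _, by rw [flipVec_supp_sd]; exact hx.2⟩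
  · intro E hE
    rw [Finset.mem_filter] at hE ⊢
    exact ⟨Finset.mem_univ _, hE.2⟩
  · intro x _; exact flipVec_supp_sd x
  · intro E _; exact supp_flipVec_sd E
  · intro x _; rfl

open Classical in
/-- **FGL18 Theorem 1 with the printed threshold value under i.i.d. DEPOLARIZING noise** (sector-wise small-set-flip
decoding of the CSS code `CSSCode.ofMatrices (expanderHX H) (expanderHZ H)`; union bound through the marginals, which are
i.i.d. of parameter `2p/3` — "the `X`-type errors (resp. `Z`-type errors) produced by a depolarizing channel … are
independent with parameter `2p/3`"): for a `(Δ_A,Δ_B)`-biregular `(γ_A,δ_A,γ_B,δ_B)`-expanding `G` with `β̃ > 0`, every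
`κ ≤ β̃·max(Δ_A,Δ_B)`, every pair of small-set-flip decoders `D₁` (syndromes `expanderHZ H`, flips in the rows of
`expanderHX H`) and `D₂` (syndromes `expanderHX H`, flips in the rows of `expanderHZ H`), and every depolarizing rate
`0 < p ≤ 1` with `2p/3 < p_ls(Δ_𝒢, α)`: `P_fail^depol(p) ≤ 2 ×` the bound of `fgl18_theorem1_sharp` at parameter `2p/3`.
So the depolarizing threshold of OUR sharp theorem is `(3/2)·p_ls(Δ_𝒢, α)` (at `(38,39,1/38,1/39)`: `1.333·10⁻¹⁶`).
STATUS: printed theorem + printed §2.4 remark, OUR explicit constants.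
[cite: FawziGrospellierLeverrier2018, Thm 1 (§1, arXiv v2 p0004) and §2.4 (remark after Def 7: depolarizing marginals 2p/3, p0010 L23)] -/
theorem fgl18_theorem1_sharp_depolarizing (H : Matrix B A (ZMod 2)) {dA dB : ℕ} {γA δA γB δB : ℝ}
    (hreg : IsBiregular H dA dB) (hexp : IsLeftRightExpanding H dA dB γA δA γB δB)
    (hdA : 0 < dA) (hdB : 0 < dB) (hγA : 0 < γA) (hδA : 0 < δA) (hγB : 0 < γB) (hδB : 0 < δB)
    (hβ : 0 < betaZero (min dA dB) (max dA dB) δA δB)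
    {κ : ℝ} (hκ : κ ≤ betaZero (min dA dB) (max dA dB) δA δB * ((max dA dB : ℕ) : ℝ))
    {D₁ : Decoder (B × A → ZMod 2) ((A × A) ⊕ (B × B) → ZMod 2)}
    {D₂ : Decoder (A × B → ZMod 2) ((A × A) ⊕ (B × B) → ZMod 2)}
    (hD₁ : IsSSFDecoder κ (expanderHZ H) (expanderHX H) D₁) (hD₂ : IsSSFDecoder κ (expanderHX H) (expanderHZ H) D₂)
    {p : ℝ} (hp0 : 0 < p) (hp1 : p ≤ 1)
    (hp : 2 * p / 3 < percolationValue (2 * max dA dB * (dA + dB))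
      (betaZero (min dA dB) (max dA dB) δA δB / (1 + betaZero (min dA dB) (max dA dB) δA δB))) :
    (CSSCode.ofMatrices (expanderHX H) (expanderHZ H) (expanderHX_mul_expanderHZ_transpose H)).depolarizingFailureProb
        D₁ D₂ p
      ≤ 2 * ((1 / ((1 - Real.exp (Real.binEntropy
                  (betaZero (min dA dB) (max dA dB) δA δB / (1 + betaZero (min dA dB) (max dA dB) δA δB)) /
                (betaZero (min dA dB) (max dA dB) δA δB / (1 + betaZero (min dA dB) (max dA dB) δA δB))) * (2 * p / 3)) *
              (1 - ((2 * p / 3) / percolationValue (2 * max dA dB * (dA + dB))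
                (betaZero (min dA dB) (max dA dB) δA δB / (1 + betaZero (min dA dB) (max dA dB) δA δB))) ^
                  (betaZero (min dA dB) (max dA dB) δA δB / (1 + betaZero (min dA dB) (max dA dB) δA δB))))) *
        ((Fintype.card A : ℝ) ^ 2 + (Fintype.card B : ℝ) ^ 2) *
        ((2 * p / 3) / percolationValue (2 * max dA dB * (dA + dB))
            (betaZero (min dA dB) (max dA dB) δA δB / (1 + betaZero (min dA dB) (max dA dB) δA δB))) ^
          ((betaZero (min dA dB) (max dA dB) δA δB / (1 + betaZero (min dA dB) (max dA dB) δA δB)) *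
            ((⌊((min dA dB : ℕ) : ℝ) / ((max dA dB : ℕ) : ℝ) * betaZero (min dA dB) (max dA dB) δA δB
                / (1 + betaZero (min dA dB) (max dA dB) δA δB) * min (γA * Fintype.card A) (γB * Fintype.card B)⌋₊
                + 1 : ℕ) : ℝ))) := by
  set Cc := CSSCode.ofMatrices (expanderHX H) (expanderHZ H) (expanderHX_mul_expanderHZ_transpose H) with hCc
  have hr0 : 0 < 2 * p / 3 := by positivity
  have hr1 : 2 * p / 3 ≤ 1 := by linarith
  have hμ : IsLocallyStochastic (bernoulliWeight (V := (A × A) ⊕ (B × B)) (2 * p / 3)) (2 * p / 3) :=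
    isLocallyStochastic_bernoulliWeight hr0.le hr1
  -- the union bound through the marginals
  have hub := CSSCode.depolarizingFailureProb_le Cc D₁ D₂ hp0.le hp1
  -- the two marginal failure probabilities, re-indexed by supports, are FGL sums
  have hS1 : (∑ x ∈ univ.filter (fun x : (A × A) ⊕ (B × B) → ZMod 2 =>
        ¬ D₁.Corrects Cc.xSyndrome (Cc.rowSpX : Set ((A × A) ⊕ (B × B) → ZMod 2)) x),
          bernoulliWeight (2 * p / 3) (supp x))
      = ∑ E ∈ univ.filter (fun E : Finset ((A × A) ⊕ (B × B)) =>
          ¬ D₁.Corrects (fun x => expanderHZ H *ᵥ x) (rowSpace (expanderHX H) : Set _) (flipVec E)),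
          bernoulliWeight (2 * p / 3) E :=
    sum_filter_supp_eq_sd (fun x => ¬ D₁.Corrects Cc.xSyndrome (Cc.rowSpX : Set ((A × A) ⊕ (B × B) → ZMod 2)) x) _
  have hS2 : (∑ z ∈ univ.filter (fun z : (A × A) ⊕ (B × B) → ZMod 2 =>
        ¬ D₂.Corrects Cc.zSyndrome (Cc.rowSpZ : Set ((A × A) ⊕ (B × B) → ZMod 2)) z),
          bernoulliWeight (2 * p / 3) (supp z))
      = ∑ E ∈ univ.filter (fun E : Finset ((A × A) ⊕ (B × B)) =>
          ¬ D₂.Corrects (fun x => expanderHX H *ᵥ x) (rowSpace (expanderHZ H) : Set _) (flipVec E)),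
          bernoulliWeight (2 * p / 3) E :=
    sum_filter_supp_eq_sd (fun z => ¬ D₂.Corrects Cc.zSyndrome (Cc.rowSpZ : Set ((A × A) ⊕ (B × B) → ZMod 2)) z) _
  have hb1 := fgl18_theorem1_sharp_zsector H hreg hexp hdA hdB hγA hδA hγB hδB hβ hκ hD₁ hμ hr0 hp
  have hb2 := fgl18_theorem1_sharp H hreg hexp hdA hdB hγA hδA hγB hδB hβ hκ hD₂ hμ hr0 hp
  calc Cc.depolarizingFailureProb D₁ D₂ p ≤ _ := hub
    _ = _ := by rw [hS1, hS2]
    _ ≤ _ := add_le_add hb1 hb2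
    _ = _ := by ring

end SharpDepol

end QuantumExpander

end Literature.InformationTheory.QuantumCodes
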